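import Summits.QuantumFields.YangMills.Theorems.BalabanLadderNTBoundaryLawPairOscillation
import Summits.QuantumFields.YangMills.Theorems.BalabanLadderNTReferenceTorusThreePoint
import Mathlib.Topology.MetricSpace.Thickening
import HarnessLib

/-!
# Seam `UVSeamRec` (stmt-QuantumFields-20043), conjunct 3 of `stub_floorsEngine`: the three-point floor on every
# torus from ONE torus per coupling WITHOUT the two-point ceiling — E1-osc ∧ E3-osc ∧ (R3′) suffice

Helper file (`--supports stmt-QuantumFields-20043`; owner R78: seam currency №1, THREE-POINT CONJUNCT supplier) of the
fleet lead prover of crux `NT` (unit `ym-spine-19353-p1`, g5); route-independent.  CLAUSE SERVED: conjunct 3 (the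
`|Q3(f,g,h)| ≥ ε` floor, compactly supported pairwise-disjoint witnesses) of the registered v4-F `stub_floorsEngine`.

The periodic-reference supply of conjunct 3 (g4 `Reference.q3_floor_of_torusReference`; g5 signed / modulated
currencies) assumes THREE exterior-oscillation ceilings E1/E2/E3-osc.  In the law of total cumulance behind the
transfer (`Reference.abs_torusK3_sub_torusK3_le`) the pair oscillation `w` only enters multiplied by a one-point
oscillation `k = C₁(aβ/κ)⁴`, which already carries the collar gain; so the gain-less pair bound from E1-osc ALONE
(`BoundaryLaw.kerCov_osc_of_e1osc`: `w′(p,q) = 8·8⁸C₁²/‖q−p‖⁸` for `16 ≤ ‖q−p‖ ≤ depth`) suffices, with per-triple margin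
`M₃′ = 2(k w′_{yz} + k w′_{xz} + k w′_{xy} + k³) + ω₃` — `O(κ⁻⁴)` in the collar like the registered `M₃`.  Only
cross-support pairs carry weight; they are `≥ δ₀/aβ ≥ 16` lattice units apart for large `β` (disjoint compact supports)
and `≤ 2σ/aβ ≤ κ/aβ ≤ depth` apart (supports in the ball of radius `σ`, collar `κ ≥ 2σ`).  NET: **E2-osc is NOT an
input of conjunct 3** (it stays an input of the reference-route supply of conjunct 2, where `w` enters bare; the seam's
conjunct 2 comes from the one-point Markov–mirror package, p512282, «together with ANY supplier of the three-point
conjunct» — this file is one).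

* `exists_sep_of_disjoint_tsupport`, `abs_sum₃_sub_sum₃_le_of_ne` (per-triple bound needed only where all three
  weights are non-zero), `triple_transfer_torus_noE2` (per triple, from E1-osc ∧ E3-osc at one coupling);
* **`q3_floor_of_torusReference_noE2`** — `a > 0`, `a → 0`, `C₁, C₃ ≥ 0`, `σ > 0`, `2σ ≤ κ`, `2(σ+κ) < ℓ`, E1-osc, E3-osc,
  `|Q3| ≥ ε + M₃′` on ONE torus `2L₀(β)+1` per coupling ⇒ `|Q3| ≥ ε` on every torus with `aβ·L ≥ σ+κ+1`, eventually;
* `threePointConjunct_of_torusReference_noE2` / `threePointConjunct_of_torusSigned_noE2` — conjunct 3 verbatim from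
  the unsigned, resp. SIGNED (`Q3 ≤ −(ε + M₃′)`, card `skewness-from-asymptotic-freedom`, `σ = −1`) one-torus floor.
  General `(G, r, a)`; no `SU(2)`-specific step.

Refs: ENGINE-TARGET-19353 v4.2 (evidence #60 on stmt-QuantumFields-19353); `Cruxes/UVSeamRec/Lines/birth.lean`.
-/

set_option autoImplicit false

noncomputable section

open scoped SchwartzMap
open MeasureTheory Filter Topology
open Literature.MathematicalPhysics.QuantumFieldTheory Literature.MathematicalPhysics.QuantumLattice
open Literature.Probability.LatticeModels
open Summit.QuantumFields.YangMills.Cruxes.OSLegsFromFemtoAndGap.DlrCollarTransfer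
open Summit.QuantumFields.YangMills.Theorems.OSLegsFromFemtoAndGap.StubLower (siteToE_sub)
open Summit.QuantumFields.YangMills.Cruxes.NT.BoundaryLaw (kerCov_osc_of_e1osc)
namespace Summit.QuantumFields.YangMills.Cruxes.NT.Reference

/-! ## §1 Elementary: separation of disjoint supports, support-restricted triple sums -/

/-- **Disjoint supports, one of them compact, are a positive distance apart**: for test functions `f, g` with disjoint
topological supports, `tsupport f ⊆ closedBall 0 σ`, there is `δ > 0` with `δ ≤ ‖p − q‖` whenever `f p ≠ 0`, `g q ≠ 0`.
[folklore] -/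
theorem exists_sep_of_disjoint_tsupport {f g : 𝓢(EuclideanSpace ℝ (Fin 4), ℝ)} {σ : ℝ}
    (hfg : Disjoint (tsupport (f : EuclideanSpace ℝ (Fin 4) → ℝ)) (tsupport (g : EuclideanSpace ℝ (Fin 4) → ℝ)))
    (hfσ : tsupport (f : EuclideanSpace ℝ (Fin 4) → ℝ) ⊆ Metric.closedBall 0 σ) :
    ∃ δ : ℝ, 0 < δ ∧ ∀ p q : EuclideanSpace ℝ (Fin 4), f p ≠ 0 → g q ≠ 0 → δ ≤ ‖p - q‖ := by
  have hs : IsCompact (tsupport (f : EuclideanSpace ℝ (Fin 4) → ℝ)) :=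
    (isCompact_closedBall (0 : EuclideanSpace ℝ (Fin 4)) σ).of_isClosed_subset (isClosed_tsupport _) hfσ
  obtain ⟨δ, hδ, hdis⟩ := hfg.exists_cthickenings hs (isClosed_tsupport _)
  refine ⟨δ, hδ, fun p q hp hq => ?_⟩
  by_contra hlt
  push Not at hlt
  have hp' : p ∈ tsupport (f : EuclideanSpace ℝ (Fin 4) → ℝ) := subset_tsupport _ (Function.mem_support.2 hp)
  have hq' : q ∈ tsupport (g : EuclideanSpace ℝ (Fin 4) → ℝ) := subset_tsupport _ (Function.mem_support.2 hq)
  have h1 : q ∈ Metric.cthickening δ (tsupport (f : EuclideanSpace ℝ (Fin 4) → ℝ)) :=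
    Metric.mem_cthickening_of_dist_le q p δ _ hp' (by rw [dist_eq_norm, norm_sub_rev]; exact hlt.le)
  have h2 : q ∈ Metric.cthickening δ (tsupport (g : EuclideanSpace ℝ (Fin 4) → ℝ)) :=
    Metric.self_subset_cthickening _ hq'
  exact Set.disjoint_left.1 hdis h1 h2

/-- A site at which a test function supported in the ball of radius `σ` is non-zero at spacing `α > 0` has norm
`≤ σ/α` in lattice units. [folklore] -/
theorem norm_siteToE_le_of_apply_ne_zero {v : 𝓢(EuclideanSpace ℝ (Fin 4), ℝ)} {α σ : ℝ} (hα : 0 < α)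
    (hv : tsupport (v : EuclideanSpace ℝ (Fin 4) → ℝ) ⊆ Metric.closedBall 0 σ) {x : Fin 4 → ℤ}
    (hx : v (α • siteToE x) ≠ 0) : ‖siteToE x‖ ≤ σ / α := by
  have hmem : α • siteToE x ∈ tsupport (v : EuclideanSpace ℝ (Fin 4) → ℝ) :=
    subset_tsupport _ (Function.mem_support.2 hx)
  have hball := hv hmem
  rw [mem_closedBall_zero_iff, norm_smul, Real.norm_eq_abs, abs_of_pos hα] at hball
  rw [le_div_iff₀ hα]; linarith

/-- Lattice separation of two sites read at spacing `α > 0`: `‖α•y − α•x‖ = α ‖y − x‖`. [folklore] -/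
theorem norm_smul_siteToE_sub (α : ℝ) (hα : 0 < α) (x y : Fin 4 → ℤ) :
    ‖α • siteToE y - α • siteToE x‖ = α * ‖siteToE (y - x)‖ := by
  rw [← smul_sub, norm_smul, Real.norm_eq_abs, abs_of_pos hα, siteToE_sub]

/-- **Support-restricted triple-sum comparison**: the per-triple bound is only needed where all three weights are
non-zero. [folklore] -/
theorem abs_sum₃_sub_sum₃_le_of_ne {ι : Type*} (s : Finset ι) (f g h : ι → ℝ) (t u e : ι → ι → ι → ℝ)
    (H : ∀ x ∈ s, ∀ y ∈ s, ∀ z ∈ s, f x ≠ 0 → g y ≠ 0 → h z ≠ 0 → |t x y z - u x y z| ≤ e x y z) :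
    |∑ x ∈ s, ∑ y ∈ s, ∑ z ∈ s, f x * g y * h z * t x y z -
        ∑ x ∈ s, ∑ y ∈ s, ∑ z ∈ s, f x * g y * h z * u x y z| ≤
      ∑ x ∈ s, ∑ y ∈ s, ∑ z ∈ s, |f x| * |g y| * |h z| * e x y z := by
  rw [← Finset.sum_sub_distrib]
  refine (Finset.abs_sum_le_sum_abs _ _).trans (Finset.sum_le_sum fun x hx => ?_)
  rw [← Finset.sum_sub_distrib]
  refine (Finset.abs_sum_le_sum_abs _ _).trans (Finset.sum_le_sum fun y hy => ?_)
  rw [← Finset.sum_sub_distrib]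
  refine (Finset.abs_sum_le_sum_abs _ _).trans (Finset.sum_le_sum fun z hz => ?_)
  have e₀ : f x * g y * h z * t x y z - f x * g y * h z * u x y z = f x * g y * h z * (t x y z - u x y z) := by ring
  rw [e₀, abs_mul, abs_mul, abs_mul]
  by_cases hf : f x = 0
  · simp [hf]
  by_cases hg : g y = 0
  · simp [hg]
  by_cases hh : h z = 0
  · simp [hh]
  exact mul_le_mul_of_nonneg_left (H x hx y hy z hz hf hg hh)
    (mul_nonneg (mul_nonneg (abs_nonneg _) (abs_nonneg _)) (abs_nonneg _))

/-! ## §2 The per-triple transfer without E2-osc -/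

section Torus

variable (G : Type) [Group G] [TopologicalSpace G] [IsTopologicalGroup G] [CompactSpace G]
  [MeasurableSpace G] [BorelSpace G] (r : LatticeRep G)

/-- **Per-triple torus-to-torus transfer at coupling `β` from E1-osc ∧ E3-osc only.**  Transfer cube of radius `RP`,
femto at `β`, inside two tori `2L+1`, `2L'+1`; sites `x, y, z` of depth `≥ κ/α` (`≥ 1`), pairwise `16 ≤ ‖·‖ ≤ κ/α`
apart: `|torusK3_L(x,y,z) − torusK3_{L'}(x,y,z)| ≤ 2 (k w′_{yz} + k w′_{xz} + k w′_{xy} + k³) + ω₃` with `k = C₁(α/κ)⁴`,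
`w′_{pq} = 8·8⁸C₁²/‖q−p‖⁸`, `ω₃ = C₃(α/κ)⁴/(1 + min sep)⁸`. [folklore] -/
theorem triple_transfer_torus_noE2 (β : ℝ) {C₁ C₃ ℓ κ α : ℝ} (hC₁ : 0 ≤ C₁) (hC₃ : 0 ≤ C₃) (hκ : 0 < κ)
    (hα : 0 < α) {RP L L' : ℕ} (hfem : ((2 * RP + 1 : ℕ) : ℝ) * α ≤ ℓ)
    (hL : 2 * RP + 1 + 3 ≤ 2 * L + 1) (hL' : 2 * RP + 1 + 3 ≤ 2 * L' + 1)
    (H1 : ∀ (c : Fin 4 → ℤ) (b : ℕ), (b : ℝ) * α ≤ ℓ → ∀ (η η' : LGConfig 4 G) (x : Fin 4 → ℤ), 1 ≤ depth c b x →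
      |kerE G r β c b η (dens G r x) - kerE G r β c b η' (dens G r x)| ≤ C₁ / (depth c b x : ℝ) ^ 4)
    (H3 : ∀ (c : Fin 4 → ℤ) (b : ℕ), (b : ℝ) * α ≤ ℓ → ∀ (η η' : LGConfig 4 G) (x y z : Fin 4 → ℤ),
      1 ≤ depth c b x → 1 ≤ depth c b y → 1 ≤ depth c b z →
        |kerK3 G r β c b η x y z - kerK3 G r β c b η' x y z| ≤
          C₃ / ((min (min (depth c b x) (depth c b y)) (depth c b z) : ℕ) : ℝ) ^ 4 /
            (1 + min (min ‖siteToE (y - x)‖ ‖siteToE (z - y)‖) ‖siteToE (z - x)‖) ^ 8)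
    {x y z : Fin 4 → ℤ}
    (hx : κ / α ≤ (depth (fun _ => -(RP : ℤ)) (2 * RP + 1) x : ℝ) ∧ 1 ≤ depth (fun _ => -(RP : ℤ)) (2 * RP + 1) x)
    (hy : κ / α ≤ (depth (fun _ => -(RP : ℤ)) (2 * RP + 1) y : ℝ) ∧ 1 ≤ depth (fun _ => -(RP : ℤ)) (2 * RP + 1) y)
    (hz : κ / α ≤ (depth (fun _ => -(RP : ℤ)) (2 * RP + 1) z : ℝ) ∧ 1 ≤ depth (fun _ => -(RP : ℤ)) (2 * RP + 1) z)
    (hxy : (16 : ℝ) ≤ ‖siteToE (y - x)‖) (hxz : (16 : ℝ) ≤ ‖siteToE (z - x)‖)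
    (hyz : (16 : ℝ) ≤ ‖siteToE (z - y)‖)
    (hxy' : ‖siteToE (y - x)‖ ≤ κ / α) (hxz' : ‖siteToE (z - x)‖ ≤ κ / α) (hyz' : ‖siteToE (z - y)‖ ≤ κ / α) :
    |torusK3 G r β L x y z - torusK3 G r β L' x y z| ≤
      2 * ((C₁ * (α / κ) ^ 4) * (8 * 8 ^ 8 * C₁ ^ 2 / ‖siteToE (z - y)‖ ^ 8) +
            (C₁ * (α / κ) ^ 4) * (8 * 8 ^ 8 * C₁ ^ 2 / ‖siteToE (z - x)‖ ^ 8) +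
            (C₁ * (α / κ) ^ 4) * (8 * 8 ^ 8 * C₁ ^ 2 / ‖siteToE (y - x)‖ ^ 8) +
            (C₁ * (α / κ) ^ 4) * (C₁ * (α / κ) ^ 4) * (C₁ * (α / κ) ^ 4)) +
        C₃ * (α / κ) ^ 4 / (1 + min (min ‖siteToE (y - x)‖ ‖siteToE (z - y)‖) ‖siteToE (z - x)‖) ^ 8 := by
  obtain ⟨hxκ, hx1⟩ := hx
  obtain ⟨hyκ, hy1⟩ := hy
  obtain ⟨hzκ, hz1⟩ := hz
  have hfem' : ((2 * RP + 1 : ℕ) : ℝ) * α ≤ ℓ := hfem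
  have ho : ∀ {u : Fin 4 → ℤ}, κ / α ≤ (depth (fun _ => -(RP : ℤ)) (2 * RP + 1) u : ℝ) →
      1 ≤ depth (fun _ => -(RP : ℤ)) (2 * RP + 1) u →
      ∀ ζ ζ', |kerE G r β (fun _ => -(RP : ℤ)) (2 * RP + 1) ζ (dens G r u) -
        kerE G r β (fun _ => -(RP : ℤ)) (2 * RP + 1) ζ' (dens G r u)| ≤ C₁ * (α / κ) ^ 4 :=
    fun huκ hu1 ζ ζ' => (H1 _ _ hfem' ζ ζ' _ hu1).trans (div_pow_depth_le hC₁ hκ hα huκ)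
  have hw : ∀ {p q : Fin 4 → ℤ}, κ / α ≤ (depth (fun _ => -(RP : ℤ)) (2 * RP + 1) p : ℝ) →
      κ / α ≤ (depth (fun _ => -(RP : ℤ)) (2 * RP + 1) q : ℝ) →
      (16 : ℝ) ≤ ‖siteToE (q - p)‖ → ‖siteToE (q - p)‖ ≤ κ / α →
      ∀ ζ ζ', |kerCov G r β (fun _ => -(RP : ℤ)) (2 * RP + 1) ζ (dens G r p) (dens G r q) -
        kerCov G r β (fun _ => -(RP : ℤ)) (2 * RP + 1) ζ' (dens G r p) (dens G r q)| ≤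
        8 * 8 ^ 8 * C₁ ^ 2 / ‖siteToE (q - p)‖ ^ 8 :=
    fun hpκ hqκ hn hνκ ζ ζ' => kerCov_osc_of_e1osc G r β hC₁ hα H1 hfem' ζ ζ' _ _ hn (hνκ.trans hpκ) (hνκ.trans hqκ)
  have hpos3 : 0 < (1 + min (min ‖siteToE (y - x)‖ ‖siteToE (z - y)‖) ‖siteToE (z - x)‖) ^ 8 := by positivity
  have hmin3 : κ / α ≤ ((min (min (depth (fun _ => -(RP : ℤ)) (2 * RP + 1) x)
      (depth (fun _ => -(RP : ℤ)) (2 * RP + 1) y)) (depth (fun _ => -(RP : ℤ)) (2 * RP + 1) z) : ℕ) : ℝ) := by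
    rw [Nat.cast_min, Nat.cast_min]; exact le_min (le_min hxκ hyκ) hzκ
  have ho3 : ∀ ζ ζ', |kerK3 G r β (fun _ => -(RP : ℤ)) (2 * RP + 1) ζ x y z -
      kerK3 G r β (fun _ => -(RP : ℤ)) (2 * RP + 1) ζ' x y z| ≤
      C₃ * (α / κ) ^ 4 / (1 + min (min ‖siteToE (y - x)‖ ‖siteToE (z - y)‖) ‖siteToE (z - x)‖) ^ 8 :=
    fun ζ ζ' => (H3 _ _ hfem' ζ ζ' x y z hx1 hy1 hz1).trans
      (div_le_div_of_nonneg_right (div_pow_depth_le hC₃ hκ hα hmin3) hpos3.le)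
  exact abs_torusK3_sub_torusK3_le G r β _ _ L L' hL hL' hx1 hy1 hz1 (ho hxκ hx1) (ho hyκ hy1) (ho hzκ hz1)
    (hw hyκ hzκ hyz hyz') (hw hxκ hzκ hxz hxz') (hw hxκ hyκ hxy hxy') ho3

/-! ## §3 The three-point floor on every torus from ONE torus per coupling, without E2-osc -/

/-- **`|Q3| ≥ ε` on every large torus from E1-osc ∧ E3-osc ∧ a floor with margin `M₃′` on ONE torus per coupling**
(explicit witnesses).  `a > 0`, `a → 0`; `C₁, C₃ ≥ 0`; `σ > 0`, `2σ ≤ κ`, `2(σ+κ) < ℓ`; E1-osc, E3-osc; test functions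
`f, g, h` with pairwise disjoint supports in the ball of radius `σ`; for `β ≥ β₅` one torus `2L₀(β)+1` with
`aβ·L₀(β) ≥ σ+κ+1` on which `|Q3_{β,L₀(β)}(f,g,h)| ≥ ε + M₃′(β)`, `M₃′` the E2-free per-triple margin summed against
`|f||g||h|`.  Then, eventually in `β`, `|Q3_{β,L}(f,g,h)| ≥ ε` on every torus `2L+1` with `aβ·L ≥ σ+κ+1`. [folklore] -/
theorem q3_floor_of_torusReference_noE2 (a : ℝ → ℝ) (ha₀ : ∀ β, 0 < a β) (ha : Tendsto a atTop (𝓝 0))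
    {C₁ C₃ ℓ σ κ : ℝ} (hC₁ : 0 ≤ C₁) (hC₃ : 0 ≤ C₃) (hσ : 0 < σ) (hσκ : 2 * σ ≤ κ) (hℓ : 2 * (σ + κ) < ℓ)
    (hE1 : ∃ β₁ : ℝ, ∀ β : ℝ, β₁ ≤ β → ∀ (c : Fin 4 → ℤ) (b : ℕ), (b : ℝ) * a β ≤ ℓ →
      ∀ (η η' : LGConfig 4 G) (x : Fin 4 → ℤ), 1 ≤ depth c b x →
        |kerE G r β c b η (dens G r x) - kerE G r β c b η' (dens G r x)| ≤ C₁ / (depth c b x : ℝ) ^ 4)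
    (hE3 : ∃ β₃ : ℝ, ∀ β : ℝ, β₃ ≤ β → ∀ (c : Fin 4 → ℤ) (b : ℕ), (b : ℝ) * a β ≤ ℓ →
      ∀ (η η' : LGConfig 4 G) (x y z : Fin 4 → ℤ), 1 ≤ depth c b x → 1 ≤ depth c b y → 1 ≤ depth c b z →
        |kerK3 G r β c b η x y z - kerK3 G r β c b η' x y z| ≤
          C₃ / ((min (min (depth c b x) (depth c b y)) (depth c b z) : ℕ) : ℝ) ^ 4 /
            (1 + min (min ‖siteToE (y - x)‖ ‖siteToE (z - y)‖) ‖siteToE (z - x)‖) ^ 8)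
    (f g h : 𝓢(EuclideanSpace ℝ (Fin 4), ℝ)) (ε β₅ : ℝ) (L₀ : ℝ → ℕ)
    (hfg : Disjoint (tsupport (f : EuclideanSpace ℝ (Fin 4) → ℝ)) (tsupport (g : EuclideanSpace ℝ (Fin 4) → ℝ)))
    (hgh : Disjoint (tsupport (g : EuclideanSpace ℝ (Fin 4) → ℝ)) (tsupport (h : EuclideanSpace ℝ (Fin 4) → ℝ)))
    (hfh : Disjoint (tsupport (f : EuclideanSpace ℝ (Fin 4) → ℝ)) (tsupport (h : EuclideanSpace ℝ (Fin 4) → ℝ)))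
    (hfσ : tsupport (f : EuclideanSpace ℝ (Fin 4) → ℝ) ⊆ Metric.closedBall 0 σ)
    (hgσ : tsupport (g : EuclideanSpace ℝ (Fin 4) → ℝ) ⊆ Metric.closedBall 0 σ)
    (hhσ : tsupport (h : EuclideanSpace ℝ (Fin 4) → ℝ) ⊆ Metric.closedBall 0 σ)
    (HR : ∀ β : ℝ, β₅ ≤ β → σ + κ + 1 ≤ a β * L₀ β ∧
      ε + ∑ x ∈ box 4 (L₀ β), ∑ y ∈ box 4 (L₀ β), ∑ z ∈ box 4 (L₀ β),
          |f (a β • siteToE x)| * |g (a β • siteToE y)| * |h (a β • siteToE z)| *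
            (2 * ((C₁ * (a β / κ) ^ 4) * (8 * 8 ^ 8 * C₁ ^ 2 / ‖siteToE (z - y)‖ ^ 8) +
                  (C₁ * (a β / κ) ^ 4) * (8 * 8 ^ 8 * C₁ ^ 2 / ‖siteToE (z - x)‖ ^ 8) +
                  (C₁ * (a β / κ) ^ 4) * (8 * 8 ^ 8 * C₁ ^ 2 / ‖siteToE (y - x)‖ ^ 8) +
                  (C₁ * (a β / κ) ^ 4) * (C₁ * (a β / κ) ^ 4) * (C₁ * (a β / κ) ^ 4)) +
              C₃ * (a β / κ) ^ 4 / (1 + min (min ‖siteToE (y - x)‖ ‖siteToE (z - y)‖) ‖siteToE (z - x)‖) ^ 8) ≤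
        |Q3 G r β (L₀ β) (a β) f g h|) :
    ∃ β₅' : ℝ, ∀ β : ℝ, β₅' ≤ β → ∀ L : ℕ, σ + κ + 1 ≤ a β * L → ε ≤ |Q3 G r β L (a β) f g h| := by
  obtain ⟨β₁, H1⟩ := hE1
  obtain ⟨β₃, H3⟩ := hE3
  have hκ : 0 < κ := by linarith
  -- separations of the three disjoint support pairs
  obtain ⟨δ₁, hδ₁, S₁⟩ := exists_sep_of_disjoint_tsupport hfg hfσ
  obtain ⟨δ₂, hδ₂, S₂⟩ := exists_sep_of_disjoint_tsupport hfh hfσ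
  obtain ⟨δ₃, hδ₃, S₃⟩ := exists_sep_of_disjoint_tsupport hgh hgσ
  set δ₀ : ℝ := min (min δ₁ δ₂) δ₃ with hδ₀
  have hδ₀pos : 0 < δ₀ := lt_min (lt_min hδ₁ hδ₂) hδ₃
  have hδ : 0 < min (min (1 / 4 : ℝ) ((ℓ - 2 * (σ + κ)) / 5)) (δ₀ / 16) :=
    lt_min (lt_min (by norm_num) (by linarith)) (by linarith)
  obtain ⟨βa, Ha⟩ := eventually_le_of_tendsto ha hδ
  refine ⟨max (max β₅ βa) (max β₁ β₃), fun β hβ L hL => ?_⟩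
  have hβ₅ : β₅ ≤ β := le_trans (le_max_left _ _) (le_trans (le_max_left _ _) hβ)
  have hβa : βa ≤ β := le_trans (le_max_right _ _) (le_trans (le_max_left _ _) hβ)
  have hβ₁ : β₁ ≤ β := le_trans (le_max_left _ _) (le_trans (le_max_right _ _) hβ)
  have hβ₃ : β₃ ≤ β := le_trans (le_max_right _ _) (le_trans (le_max_right _ _) hβ)
  have hα : 0 < a β := ha₀ β
  have hsmall := Ha β hβa
  have h4 : a β ≤ 1 / 4 := hsmall.trans ((min_le_left _ _).trans (min_le_left _ _))
  have hℓ' : a β ≤ (ℓ - 2 * (σ + κ)) / 5 := hsmall.trans ((min_le_left _ _).trans (min_le_right _ _))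
  have h16 : a β ≤ δ₀ / 16 := hsmall.trans (min_le_right _ _)
  have hρ' : a β ≤ ((σ + κ + 2 * a β) - σ - κ) / 2 := by linarith
  obtain ⟨hL₀, HRβ⟩ := HR β hβ₅
  obtain ⟨-, hfem, hLL, hNL, -, hdep⟩ := scales hα hσ hκ h4 hρ' hℓ' hL (RP := ⌈(σ + κ) / a β⌉₊ + 1) rfl
  obtain ⟨-, -, hLL₀, hNL₀, -, -⟩ := scales hα hσ hκ h4 hρ' hℓ' hL₀ (RP := ⌈(σ + κ) / a β⌉₊ + 1) rfl
  set N := ⌈σ / a β⌉₊ with hN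
  have hf0 : ∀ x, x ∉ box 4 N → f (a β • siteToE x) = 0 := fun x hx => apply_smul_siteToE_eq_zero hα hfσ hx
  have hg0 : ∀ y, y ∉ box 4 N → g (a β • siteToE y) = 0 := fun y hy => apply_smul_siteToE_eq_zero hα hgσ hy
  have hh0 : ∀ z, z ∉ box 4 N → h (a β • siteToE z) = 0 := fun z hz => apply_smul_siteToE_eq_zero hα hhσ hz
  -- lattice separation of a cross-support pair: `16 ≤ ‖q − p‖ ≤ κ / aβ`
  have sep_lo : ∀ {v w : 𝓢(EuclideanSpace ℝ (Fin 4), ℝ)} {δ : ℝ}, δ₀ ≤ δ →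
      (∀ p q : EuclideanSpace ℝ (Fin 4), v p ≠ 0 → w q ≠ 0 → δ ≤ ‖p - q‖) →
      ∀ {p q : Fin 4 → ℤ}, v (a β • siteToE p) ≠ 0 → w (a β • siteToE q) ≠ 0 →
        (16 : ℝ) ≤ ‖siteToE (q - p)‖ := by
    intro v w δ hδδ S p q hp hq
    have h1 := S _ _ hp hq
    rw [norm_sub_rev, norm_smul_siteToE_sub (a β) hα p q] at h1
    have h2 : δ₀ ≤ a β * ‖siteToE (q - p)‖ := hδδ.trans h1
    have h3 : 16 * a β ≤ δ₀ := by linarith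
    nlinarith [norm_nonneg (siteToE (q - p)), hα]
  have sep_hi : ∀ {v w : 𝓢(EuclideanSpace ℝ (Fin 4), ℝ)},
      tsupport (v : EuclideanSpace ℝ (Fin 4) → ℝ) ⊆ Metric.closedBall 0 σ →
      tsupport (w : EuclideanSpace ℝ (Fin 4) → ℝ) ⊆ Metric.closedBall 0 σ →
      ∀ {p q : Fin 4 → ℤ}, v (a β • siteToE p) ≠ 0 → w (a β • siteToE q) ≠ 0 →
        ‖siteToE (q - p)‖ ≤ κ / a β := by
    intro v w hv hw p q hp hq
    have h1 := norm_siteToE_le_of_apply_ne_zero hα hv hp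
    have h2 := norm_siteToE_le_of_apply_ne_zero hα hw hq
    rw [siteToE_sub]
    calc ‖siteToE q - siteToE p‖ ≤ ‖siteToE q‖ + ‖siteToE p‖ := norm_sub_le _ _
      _ ≤ σ / a β + σ / a β := add_le_add h2 h1
      _ = 2 * σ / a β := by ring
      _ ≤ κ / a β := div_le_div_of_nonneg_right hσκ hα.le
  have htriple : ∀ x ∈ box 4 N, ∀ y ∈ box 4 N, ∀ z ∈ box 4 N,
      f (a β • siteToE x) ≠ 0 → g (a β • siteToE y) ≠ 0 → h (a β • siteToE z) ≠ 0 →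
      |torusK3 G r β L x y z - torusK3 G r β (L₀ β) x y z| ≤
      2 * ((C₁ * (a β / κ) ^ 4) * (8 * 8 ^ 8 * C₁ ^ 2 / ‖siteToE (z - y)‖ ^ 8) +
            (C₁ * (a β / κ) ^ 4) * (8 * 8 ^ 8 * C₁ ^ 2 / ‖siteToE (z - x)‖ ^ 8) +
            (C₁ * (a β / κ) ^ 4) * (8 * 8 ^ 8 * C₁ ^ 2 / ‖siteToE (y - x)‖ ^ 8) +
            (C₁ * (a β / κ) ^ 4) * (C₁ * (a β / κ) ^ 4) * (C₁ * (a β / κ) ^ 4)) +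
        C₃ * (a β / κ) ^ 4 / (1 + min (min ‖siteToE (y - x)‖ ‖siteToE (z - y)‖) ‖siteToE (z - x)‖) ^ 8 :=
    fun x hx y hy z hz hfx hgy hhz =>
      triple_transfer_torus_noE2 G r β hC₁ hC₃ hκ hα hfem hLL hLL₀ (H1 β hβ₁) (H3 β hβ₃) (hdep x hx) (hdep y hy)
        (hdep z hz) (sep_lo ((min_le_left _ _).trans (min_le_left _ _)) S₁ hfx hgy)
        (sep_lo ((min_le_left _ _).trans (min_le_right _ _)) S₂ hfx hhz) (sep_lo (min_le_right _ _) S₃ hgy hhz)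
        (sep_hi hfσ hgσ hfx hgy) (sep_hi hfσ hhσ hfx hhz) (sep_hi hgσ hhσ hgy hhz)
  have eQ : ∀ M : ℕ, N ≤ M → Q3 G r β M (a β) f g h = ∑ x ∈ box 4 N, ∑ y ∈ box 4 N, ∑ z ∈ box 4 N,
      f (a β • siteToE x) * g (a β • siteToE y) * h (a β • siteToE z) * torusK3 G r β M x y z := fun M hM => by
    unfold Q3
    exact sum_box₃_eq hM _ (fun x hx y z => by rw [hf0 x hx]; ring) (fun y hy x z => by rw [hg0 y hy]; ring)
      (fun z hz x y => by rw [hh0 z hz]; ring)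
  have eM : ∑ x ∈ box 4 (L₀ β), ∑ y ∈ box 4 (L₀ β), ∑ z ∈ box 4 (L₀ β),
      |f (a β • siteToE x)| * |g (a β • siteToE y)| * |h (a β • siteToE z)| *
        (2 * ((C₁ * (a β / κ) ^ 4) * (8 * 8 ^ 8 * C₁ ^ 2 / ‖siteToE (z - y)‖ ^ 8) +
              (C₁ * (a β / κ) ^ 4) * (8 * 8 ^ 8 * C₁ ^ 2 / ‖siteToE (z - x)‖ ^ 8) +
              (C₁ * (a β / κ) ^ 4) * (8 * 8 ^ 8 * C₁ ^ 2 / ‖siteToE (y - x)‖ ^ 8) +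
              (C₁ * (a β / κ) ^ 4) * (C₁ * (a β / κ) ^ 4) * (C₁ * (a β / κ) ^ 4)) +
          C₃ * (a β / κ) ^ 4 / (1 + min (min ‖siteToE (y - x)‖ ‖siteToE (z - y)‖) ‖siteToE (z - x)‖) ^ 8) =
      ∑ x ∈ box 4 N, ∑ y ∈ box 4 N, ∑ z ∈ box 4 N,
      |f (a β • siteToE x)| * |g (a β • siteToE y)| * |h (a β • siteToE z)| *
        (2 * ((C₁ * (a β / κ) ^ 4) * (8 * 8 ^ 8 * C₁ ^ 2 / ‖siteToE (z - y)‖ ^ 8) +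
              (C₁ * (a β / κ) ^ 4) * (8 * 8 ^ 8 * C₁ ^ 2 / ‖siteToE (z - x)‖ ^ 8) +
              (C₁ * (a β / κ) ^ 4) * (8 * 8 ^ 8 * C₁ ^ 2 / ‖siteToE (y - x)‖ ^ 8) +
              (C₁ * (a β / κ) ^ 4) * (C₁ * (a β / κ) ^ 4) * (C₁ * (a β / κ) ^ 4)) +
          C₃ * (a β / κ) ^ 4 / (1 + min (min ‖siteToE (y - x)‖ ‖siteToE (z - y)‖) ‖siteToE (z - x)‖) ^ 8) :=
    sum_box₃_eq hNL₀ _ (fun x hx y z => by rw [hf0 x hx, abs_zero]; ring)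
      (fun y hy x z => by rw [hg0 y hy, abs_zero]; ring) (fun z hz x y => by rw [hh0 z hz, abs_zero]; ring)
  have hsum := abs_sum₃_sub_sum₃_le_of_ne (box 4 N) (fun x => f (a β • siteToE x)) (fun y => g (a β • siteToE y))
    (fun z => h (a β • siteToE z)) (fun x y z => torusK3 G r β L x y z)
    (fun x y z => torusK3 G r β (L₀ β) x y z) _ htriple
  rw [eQ (L₀ β) hNL₀, eM] at HRβ
  rw [eQ L hNL]
  have tri := abs_sub_abs_le_abs_sub
    (∑ x ∈ box 4 N, ∑ y ∈ box 4 N, ∑ z ∈ box 4 N,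
      f (a β • siteToE x) * g (a β • siteToE y) * h (a β • siteToE z) * torusK3 G r β (L₀ β) x y z)
    (∑ x ∈ box 4 N, ∑ y ∈ box 4 N, ∑ z ∈ box 4 N,
      f (a β • siteToE x) * g (a β • siteToE y) * h (a β • siteToE z) * torusK3 G r β L x y z)
  rw [abs_sub_comm] at hsum
  linarith [hsum, HRβ, tri]

/-- **Conjunct 3 of `stub_floorsEngine` WITHOUT E2-osc** (unsigned one-torus floor (R3′)); general `(G, r, a)`. [folklore] -/
theorem threePointConjunct_of_torusReference_noE2 (a : ℝ → ℝ) (ha₀ : ∀ β, 0 < a β) (ha : Tendsto a atTop (𝓝 0))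
    {C₁ C₃ ℓ σ κ : ℝ} (hC₁ : 0 ≤ C₁) (hC₃ : 0 ≤ C₃) (hσ : 0 < σ) (hσκ : 2 * σ ≤ κ) (hℓ : 2 * (σ + κ) < ℓ)
    (hE1 : ∃ β₁ : ℝ, ∀ β : ℝ, β₁ ≤ β → ∀ (c : Fin 4 → ℤ) (b : ℕ), (b : ℝ) * a β ≤ ℓ →
      ∀ (η η' : LGConfig 4 G) (x : Fin 4 → ℤ), 1 ≤ depth c b x →
        |kerE G r β c b η (dens G r x) - kerE G r β c b η' (dens G r x)| ≤ C₁ / (depth c b x : ℝ) ^ 4)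
    (hE3 : ∃ β₃ : ℝ, ∀ β : ℝ, β₃ ≤ β → ∀ (c : Fin 4 → ℤ) (b : ℕ), (b : ℝ) * a β ≤ ℓ →
      ∀ (η η' : LGConfig 4 G) (x y z : Fin 4 → ℤ), 1 ≤ depth c b x → 1 ≤ depth c b y → 1 ≤ depth c b z →
        |kerK3 G r β c b η x y z - kerK3 G r β c b η' x y z| ≤
          C₃ / ((min (min (depth c b x) (depth c b y)) (depth c b z) : ℕ) : ℝ) ^ 4 /
            (1 + min (min ‖siteToE (y - x)‖ ‖siteToE (z - y)‖) ‖siteToE (z - x)‖) ^ 8)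
    (hR3 : ∃ (f g h : 𝓢(EuclideanSpace ℝ (Fin 4), ℝ)) (ε β₅ : ℝ) (L₀ : ℝ → ℕ),
      Disjoint (tsupport (f : EuclideanSpace ℝ (Fin 4) → ℝ)) (tsupport (g : EuclideanSpace ℝ (Fin 4) → ℝ)) ∧
      Disjoint (tsupport (g : EuclideanSpace ℝ (Fin 4) → ℝ)) (tsupport (h : EuclideanSpace ℝ (Fin 4) → ℝ)) ∧
      Disjoint (tsupport (f : EuclideanSpace ℝ (Fin 4) → ℝ)) (tsupport (h : EuclideanSpace ℝ (Fin 4) → ℝ)) ∧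
      tsupport (f : EuclideanSpace ℝ (Fin 4) → ℝ) ⊆ Metric.closedBall 0 σ ∧
      tsupport (g : EuclideanSpace ℝ (Fin 4) → ℝ) ⊆ Metric.closedBall 0 σ ∧
      tsupport (h : EuclideanSpace ℝ (Fin 4) → ℝ) ⊆ Metric.closedBall 0 σ ∧ 0 < ε ∧
      ∀ β : ℝ, β₅ ≤ β → σ + κ + 1 ≤ a β * L₀ β ∧
        ε + ∑ x ∈ box 4 (L₀ β), ∑ y ∈ box 4 (L₀ β), ∑ z ∈ box 4 (L₀ β),
            |f (a β • siteToE x)| * |g (a β • siteToE y)| * |h (a β • siteToE z)| *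
              (2 * ((C₁ * (a β / κ) ^ 4) * (8 * 8 ^ 8 * C₁ ^ 2 / ‖siteToE (z - y)‖ ^ 8) +
                    (C₁ * (a β / κ) ^ 4) * (8 * 8 ^ 8 * C₁ ^ 2 / ‖siteToE (z - x)‖ ^ 8) +
                    (C₁ * (a β / κ) ^ 4) * (8 * 8 ^ 8 * C₁ ^ 2 / ‖siteToE (y - x)‖ ^ 8) +
                    (C₁ * (a β / κ) ^ 4) * (C₁ * (a β / κ) ^ 4) * (C₁ * (a β / κ) ^ 4)) +
                C₃ * (a β / κ) ^ 4 / (1 + min (min ‖siteToE (y - x)‖ ‖siteToE (z - y)‖) ‖siteToE (z - x)‖) ^ 8) ≤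
          |Q3 G r β (L₀ β) (a β) f g h|) :
    ∃ (f g h : 𝓢(EuclideanSpace ℝ (Fin 4), ℝ)) (ε β₅ Λ₅ : ℝ),
      HasCompactSupport (f : EuclideanSpace ℝ (Fin 4) → ℝ) ∧
      HasCompactSupport (g : EuclideanSpace ℝ (Fin 4) → ℝ) ∧
      HasCompactSupport (h : EuclideanSpace ℝ (Fin 4) → ℝ) ∧
      Disjoint (tsupport (f : EuclideanSpace ℝ (Fin 4) → ℝ)) (tsupport (g : EuclideanSpace ℝ (Fin 4) → ℝ)) ∧
      Disjoint (tsupport (g : EuclideanSpace ℝ (Fin 4) → ℝ)) (tsupport (h : EuclideanSpace ℝ (Fin 4) → ℝ)) ∧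
      Disjoint (tsupport (f : EuclideanSpace ℝ (Fin 4) → ℝ)) (tsupport (h : EuclideanSpace ℝ (Fin 4) → ℝ)) ∧
      0 < ε ∧ ∀ β : ℝ, β₅ ≤ β → ∀ L : ℕ, Λ₅ ≤ a β * L → ε ≤ |Q3 G r β L (a β) f g h| := by
  obtain ⟨f, g, h, ε, β₅, L₀, hfg, hgh, hfh, hfσ, hgσ, hhσ, hε, HR⟩ := hR3
  obtain ⟨β₇, H⟩ := q3_floor_of_torusReference_noE2 G r a ha₀ ha hC₁ hC₃ hσ hσκ hℓ hE1 hE3 f g h ε β₅ L₀ hfg hgh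
    hfh hfσ hgσ hhσ HR
  exact ⟨f, g, h, ε, β₇, σ + κ + 1,
    (isCompact_closedBall (0 : EuclideanSpace ℝ (Fin 4)) σ).of_isClosed_subset (isClosed_tsupport _) hfσ,
    (isCompact_closedBall (0 : EuclideanSpace ℝ (Fin 4)) σ).of_isClosed_subset (isClosed_tsupport _) hgσ,
    (isCompact_closedBall (0 : EuclideanSpace ℝ (Fin 4)) σ).of_isClosed_subset (isClosed_tsupport _) hhσ,
    hfg, hgh, hfh, hε, H⟩

/-- **Conjunct 3 of `stub_floorsEngine` WITHOUT E2-osc from the SIGNED one-torus floor** `Q3 ≤ −(ε + M₃′)`. [folklore] -/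
theorem threePointConjunct_of_torusSigned_noE2 (a : ℝ → ℝ) (ha₀ : ∀ β, 0 < a β) (ha : Tendsto a atTop (𝓝 0))
    {C₁ C₃ ℓ σ κ : ℝ} (hC₁ : 0 ≤ C₁) (hC₃ : 0 ≤ C₃) (hσ : 0 < σ) (hσκ : 2 * σ ≤ κ) (hℓ : 2 * (σ + κ) < ℓ)
    (hE1 : ∃ β₁ : ℝ, ∀ β : ℝ, β₁ ≤ β → ∀ (c : Fin 4 → ℤ) (b : ℕ), (b : ℝ) * a β ≤ ℓ →
      ∀ (η η' : LGConfig 4 G) (x : Fin 4 → ℤ), 1 ≤ depth c b x →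
        |kerE G r β c b η (dens G r x) - kerE G r β c b η' (dens G r x)| ≤ C₁ / (depth c b x : ℝ) ^ 4)
    (hE3 : ∃ β₃ : ℝ, ∀ β : ℝ, β₃ ≤ β → ∀ (c : Fin 4 → ℤ) (b : ℕ), (b : ℝ) * a β ≤ ℓ →
      ∀ (η η' : LGConfig 4 G) (x y z : Fin 4 → ℤ), 1 ≤ depth c b x → 1 ≤ depth c b y → 1 ≤ depth c b z →
        |kerK3 G r β c b η x y z - kerK3 G r β c b η' x y z| ≤
          C₃ / ((min (min (depth c b x) (depth c b y)) (depth c b z) : ℕ) : ℝ) ^ 4 /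
            (1 + min (min ‖siteToE (y - x)‖ ‖siteToE (z - y)‖) ‖siteToE (z - x)‖) ^ 8)
    (hR3s : ∃ (f g h : 𝓢(EuclideanSpace ℝ (Fin 4), ℝ)) (ε β₅ : ℝ) (L₀ : ℝ → ℕ),
      Disjoint (tsupport (f : EuclideanSpace ℝ (Fin 4) → ℝ)) (tsupport (g : EuclideanSpace ℝ (Fin 4) → ℝ)) ∧
      Disjoint (tsupport (g : EuclideanSpace ℝ (Fin 4) → ℝ)) (tsupport (h : EuclideanSpace ℝ (Fin 4) → ℝ)) ∧
      Disjoint (tsupport (f : EuclideanSpace ℝ (Fin 4) → ℝ)) (tsupport (h : EuclideanSpace ℝ (Fin 4) → ℝ)) ∧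
      tsupport (f : EuclideanSpace ℝ (Fin 4) → ℝ) ⊆ Metric.closedBall 0 σ ∧
      tsupport (g : EuclideanSpace ℝ (Fin 4) → ℝ) ⊆ Metric.closedBall 0 σ ∧
      tsupport (h : EuclideanSpace ℝ (Fin 4) → ℝ) ⊆ Metric.closedBall 0 σ ∧ 0 < ε ∧
      ∀ β : ℝ, β₅ ≤ β → σ + κ + 1 ≤ a β * L₀ β ∧
        Q3 G r β (L₀ β) (a β) f g h ≤
          -(ε + ∑ x ∈ box 4 (L₀ β), ∑ y ∈ box 4 (L₀ β), ∑ z ∈ box 4 (L₀ β),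
            |f (a β • siteToE x)| * |g (a β • siteToE y)| * |h (a β • siteToE z)| *
              (2 * ((C₁ * (a β / κ) ^ 4) * (8 * 8 ^ 8 * C₁ ^ 2 / ‖siteToE (z - y)‖ ^ 8) +
                    (C₁ * (a β / κ) ^ 4) * (8 * 8 ^ 8 * C₁ ^ 2 / ‖siteToE (z - x)‖ ^ 8) +
                    (C₁ * (a β / κ) ^ 4) * (8 * 8 ^ 8 * C₁ ^ 2 / ‖siteToE (y - x)‖ ^ 8) +
                    (C₁ * (a β / κ) ^ 4) * (C₁ * (a β / κ) ^ 4) * (C₁ * (a β / κ) ^ 4)) +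
                C₃ * (a β / κ) ^ 4 / (1 + min (min ‖siteToE (y - x)‖ ‖siteToE (z - y)‖) ‖siteToE (z - x)‖) ^ 8))) :
    ∃ (f g h : 𝓢(EuclideanSpace ℝ (Fin 4), ℝ)) (ε β₅ Λ₅ : ℝ),
      HasCompactSupport (f : EuclideanSpace ℝ (Fin 4) → ℝ) ∧
      HasCompactSupport (g : EuclideanSpace ℝ (Fin 4) → ℝ) ∧
      HasCompactSupport (h : EuclideanSpace ℝ (Fin 4) → ℝ) ∧
      Disjoint (tsupport (f : EuclideanSpace ℝ (Fin 4) → ℝ)) (tsupport (g : EuclideanSpace ℝ (Fin 4) → ℝ)) ∧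
      Disjoint (tsupport (g : EuclideanSpace ℝ (Fin 4) → ℝ)) (tsupport (h : EuclideanSpace ℝ (Fin 4) → ℝ)) ∧
      Disjoint (tsupport (f : EuclideanSpace ℝ (Fin 4) → ℝ)) (tsupport (h : EuclideanSpace ℝ (Fin 4) → ℝ)) ∧
      0 < ε ∧ ∀ β : ℝ, β₅ ≤ β → ∀ L : ℕ, Λ₅ ≤ a β * L → ε ≤ |Q3 G r β L (a β) f g h| := by
  obtain ⟨f, g, h, ε, β₅, L₀, hfg, hgh, hfh, hfσ, hgσ, hhσ, hε, HR⟩ := hR3s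
  refine threePointConjunct_of_torusReference_noE2 G r a ha₀ ha hC₁ hC₃ hσ hσκ hℓ hE1 hE3
    ⟨f, g, h, ε, β₅, L₀, hfg, hgh, hfh, hfσ, hgσ, hhσ, hε, fun β hβ => ?_⟩
  obtain ⟨hL₀, hs⟩ := HR β hβ
  exact ⟨hL₀, le_abs.2 (Or.inr (by linarith))⟩

end Torus

end Summit.QuantumFields.YangMills.Cruxes.NT.Reference

end
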